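import Literature.AlgebraicGeometry.Motives.Varieties
import Mathlib.NumberTheory.NumberField.CMField
import Mathlib.Topology.Algebra.ContinuousMonoidHom
import Mathlib.CategoryTheory.Category.Preorder
import HarnessLib

/-!
# Liu 2021, Appendix C, Proposition C.5 — EXACTLY AS PRINTED (statement-exact typing; no proof)

[Liu2021] = Yifeng Liu, *Fourier–Jacobi cycles and arithmetic relative trace formula* (with an appendix by Chao Li
and Yihang Zhu), Cambridge J. Math. **9** (2021), no. 1, 1–147 = arXiv:2102.11518.  PRIMARY SOURCE READ FOR THIS FILE:
the author's TeX source of the arXiv e-print, `FJcycle.tex` (md5 `6db49a74122d2cb0f224fa1b39488a0c`, 7163 lines; held at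
`run/shared/lean/pub/pub-hodgecm/pub-hodgecm-cf-kudla-howe-rallis-g4/lit/Liu21-arxiv-src/FJcycle.tex`) — every `l. NNNN`
below is a line of that file.  Appendix C = TeX `\section{Shimura varieties for hermitian spaces}` (label `ss:c`,
l. 4544), §C.1 = `\subsection{Case of isometry}` (label `ss:appendix_isometry`, l. 4554).  NUMBERING: the appendix
shares ONE counter for definitions / remarks / propositions (as the main text does), so C.1 = Definition (reflex field,
l. 4565–4567), C.2 = Remark (label `re:picard`, l. 4602–4609), C.3 = Definition (label `de:incoherent_hermitian`,
l. 4614–4616), C.4 = Definition (label `de:nearby`, l. 4620–4622), **C.5 = Proposition (label `pr:incoherent_shimura`,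
l. 4627–4633; proof l. 4635–4637: «See [Gro, Section 10]»)**, C.6 = Definition (label `de:shimura_incoherent`,
l. 4640–4642), C.7 = Remark (l. 4644–4654), C.8 = Definition (label `de:shimura_incoherent_toroidal`, l. 4663–4665),
C.9 = Remark (l. 4667–4669); this agrees with the main text's own cross-references («(Definition C.3)» at l. 2053 points
to `de:incoherent_hermitian`, «(Definition C.6)» at l. 2060 to `de:shimura_incoherent`, «(Definition C.8)» at l. 2064 to
`de:shimura_incoherent_toroidal`) as recorded in the tree's `Literature.NumberTheory.Automorphic.Liu2021.Thm418AsPrinted`.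
Cambridge J. Math. page numbers are not held (acquisition `acq-07613`) and are not quoted.

## What this file is

The coordinator's ruling of 2026-08-21T16:13:55Z («[Liu 2021] APPENDIX C AS PRINTED, split across four typers») asks
typer 3 for Proposition C.5 «exactly as printed as `def PropC5AsPrinted : Prop` with every hypothesis a binder + a cite
binder record; list in the docstring which of Thm 4.18's hypotheses it feeds».  This file is that typing, in the style
and with the conventions of `Thm418AsPrinted.lean` (same directory): a hypothesis structure `PropC5Data F E` listing, in
paper order, the data the printed sentence names, and a PREDICATE `PropC5AsPrinted D : Prop` on it which is the printed
sentence.  NOTHING IS ASSERTED: no declaration of this file has type `PropC5AsPrinted D` or `∀ D, PropC5AsPrinted D`;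
a consumer cites Proposition C.5 by taking `(h : PropC5AsPrinted D)` for ITS OWN datum `D`.  Sibling files (other
seats): `AppendixC/DefC1toC3.lean` (Def. C.1, Rem. C.2, Def. C.3), `AppendixC/DefC4.lean` (Def. C.4),
`AppendixC/Glue.lean` (how C.1–C.5 feed the hypotheses of Thm. 4.18; the only Appendix-C module `Thm418AsPrinted`'s
successors import).  THIS FILE IMPORTS NONE OF THEM (interface-first: it must land independently); the notions of
Def. C.3 / C.4 enter Proposition C.5 only through the objects `𝕍`, `𝔾(𝔸_F^∞)`, `V(τ)`, `G(τ)(𝔸^∞)` and the fixed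
isomorphism, which are fields of `PropC5Data` (carriers, next paragraph); `Glue.lean` instantiates them on the sibling
files' definitions.

## What a CARRIER is (same convention as `Thm418AsPrinted`)

Mathlib and the tree do not construct: hermitian spaces over the adèle ring `𝔸_E` (Def. C.3), the unitary group
`𝔾 = U(𝕍)` over `𝔸_F` and its group of finite-adèlic points, the Shimura datum `(G, h^♭_{V,Φ})` / `(G(τ), h_{V(τ),τ'})`
of §C.1 and — above all — the CANONICAL MODELS `Sh(G, h)_K` of Shimura varieties over their reflex field («The theory
of Shimura varieties provides us with a projective system of schemes …», l. 4599).  Every such object that the printed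
sentence NAMES is a field of `PropC5Data`, marked **⟨CARRIER⟩** in its docstring, which quotes the printed definition of
the object with its TeX line.  A carrier is DATA supplied by a consumer; an auditor checks that each carrier of the
consumer's `D` is instantiated with the printed object.  What IS typed on genuine Mathlib / tree objects: the number
fields `F ⊆ E` with their printed hypotheses (Mathlib's CM-extension instances, as in `Thm418AsPrinted`), the sets
`Φ_F = (F →+* ℝ)` and `Φ_E = (E →+* ℂ)` with «`τ'` above `τ`» (`C5.IsAbove`), the subfield `τ'(E) ⊆ ℂ`
(`τ'.fieldRange`), open compact subgroups of a topological group and «sufficiently small» (`C5.OpenCompactSubgroup`,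
`C5.SmallLevel`), the transport of a level `K` along the fixed isomorphism (`C5.SmallLevel.transport`), SCHEMES OVER A
FIELD (the tree's `Literature.AlgebraicGeometry.Motives.SchemeOver k = Over (Spec k)`, Mathlib schemes), projective
systems of schemes (functors from the level poset), base change `− ⊗_{E,τ'} τ'(E)` (`C5.baseChangeAlong`, Mathlib's
`Over.pullback` along `Spec τ'(E) → Spec E`), and «isomorphism of projective systems of schemes over `τ'(E)`» (a natural
isomorphism of such functors).

## The printed text (verbatim from `FJcycle.tex`, TeX macros resolved: `\bV` = `𝕍`, `\bG` = `𝔾`, `\bA` = `𝔸`,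
`\dC` = `ℂ`, `\dQ` = `ℚ`, `\dR` = `ℝ`, `\rV` = `V`, `\rG` = `G`, `\rU` = `U`, `\rh` = `h`, `\tc` = `c`, `\Nm` = `Nm`)

**Standing data of Appendix C**, l. 4550: «Let `F` be a totally real number field of degree `d ≥ 1`, and `E/F` a
totally imaginary quadratic extension. Denote by `c` the nontrivial involution of `E` over `F`. Denote by `Φ_F` the set
of real embeddings of `F` and by `Φ_E` the set of complex embeddings of `E`. Let `ℕ[Φ_E]` be the commutative monoid
freely generated by `Φ_E`. The Galois group `Gal(ℂ/ℚ)` acts on `Φ_E`, hence on `ℕ[Φ_E]`. We have the projection map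
`π : Φ_E → Φ_F` given by restriction. Recall that a CM type (of `E`) is a subset `Φ` of `Φ_E` such that `π` induces a
bijection from `Φ` to `Φ_F`. For a CM type `Φ`, put `Φ^c := Φ_E ∖ Φ`, which is again a CM type.»

**§C.1, the Shimura varieties of a hermitian space** (the objects on the right-hand side of Prop. C.5).  l. 4558:
«Let `V` be a (non-degenerate) hermitian space over `E` (with respect to `c`) of rank `n ≥ 1`, with the hermitian form
`( , )_V : V × V → E` that is `E`-linear in the first variable. For every `τ ∈ Φ_F`, let `(p_τ, q_τ)` be the signature
of `V ⊗_{F,τ} ℝ`. We take a CM type `Φ ⊆ Φ_E`.»  (C.1) l. 4559–4563: «`sig_{V,Φ} := Σ_{τ ∈ Φ_F} p_τ τ^+ + Σ_{τ ∈ Φ_F}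
q_τ τ^−`, `sig^♭_{V,Φ} := Σ_{τ ∈ Φ_F} q_τ τ^−` in `ℕ[Φ_E]`. Here, `τ^−` (resp. `τ^+`) is the unique element in `Φ`
(resp. `Φ^c`) whose image under `π` is `τ`.»  Def. C.1 (l. 4565–4567): «We define the *reflex field* (resp. *reduced
reflex field*) of the pair `(V, Φ)` to be the fixed field of the stabilizer in `Gal(ℂ/ℚ)` of the element `sig_{V,Φ}`
(resp. `sig^♭_{V,Φ}`), denoted by `E_{V,Φ}` (resp. `E^♭_{V,Φ}`).»  l. 4569–4571: «Let `U(V)` be the unitary group (of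
isometry) of `V`, that is, the reductive group over `F` such that for every `F`-algebra `R`, we have
`U(V)(R) = {g ∈ GL_R(V ⊗_F R) | (gx, gy)_V = (x, y)_V for all x, y ∈ V ⊗_F R}`.»  l. 4579–4599: «Put
`G := Res_{F/ℚ} U(V)`. We define the Hodge map `h^♭_{V,Φ} : Res_{ℂ/ℝ} 𝔾_m → G_ℝ` to be the one sending
`z ∈ ℂ^× = (Res_{ℂ/ℝ} 𝔾_m)(ℝ)` to `(diag(I_{p_{τ_1}}, (z/\bar z) I_{q_{τ_1}}), …, diag(I_{p_{τ_d}}, (z/\bar z) I_{q_{τ_d}}))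
∈ G_ℝ(ℝ)`, where we identify `G_ℝ(ℝ)` as a subgroup of `GL_n(ℂ)^d` via `{τ_1^−, …, τ_d^−}`. Then we obtain a Shimura data
`(G, h^♭_{V,Φ})`. It is of abelian type but not Hodge type; and its reflex field coincides with `E^♭_{V,Φ}`. The theory
of Shimura varieties provides us with a projective system of schemes `{Sh(G, h^♭_{V,Φ})_K}_K`, quasi-projective and
smooth over `E^♭_{V,Φ}` of dimension `Σ_{τ ∈ Φ_F} p_τ q_τ`, indexed by neat open compact subgroups `K` of
`G(𝔸^∞) = U(V)(𝔸_F^∞)`.»  **Rem. C.2** (l. 4602–4603): «Suppose that there is an element `τ ∈ Φ_F` such that `V` has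
signature `(n−1, 1)` at `τ` and `(n, 0)` at other places. Then the Hodge map `h^♭_{V,Φ}` hence the Shimura variety
`Sh(G, h^♭_{V,Φ})_K` depend only on `Φ ∩ π^{−1}τ`, that is, the unique element contained in `Φ` above `τ`. Thus, for an
element `τ' ∈ Φ_E` above `τ`, we may write `h_{V,τ'}` and `Sh(G, h_{V,τ'})_K` for those `Φ` containing `τ'`. In
particular, the reflex field of `h_{V,τ'}` is `τ'(E)`.» (l. 4603–4608 then describe the Galois action on connected
components; not part of Prop. C.5.)

**Def. C.3** (l. 4614–4616): «An *incoherent hermitian space* over `𝔸_E` is a free `𝔸_E`-module `𝕍` of some rank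
`n ≥ 1`, equipped with a non-degenerate hermitian form `( , )_𝕍 : 𝕍 × 𝕍 → 𝔸_E` with respect to the (induced) involution
`c` on `𝔸_E` such that its determinant belongs to `𝔸_F^× ∖ F^× Nm_{𝔸_E/𝔸_F} 𝔸_E^×`. We say that `𝕍` is totally positive
definite if for every `τ ∈ Φ_F`, `𝕍 ⊗_{𝔸_F,τ} ℝ` is positive definite.»  **l. 4618**: «Let `𝕍` be a totally positive
definite incoherent hermitian space over `𝔸_E` of rank `n ≥ 1`, and let `𝔾 := U(𝕍)` be its group of isometry, which is
a reductive group over `𝔸_F`.»  **Def. C.4** (l. 4620–4622): «For `τ ∈ Φ_F`, we say that a hermitian space `V` over `E`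
is *`τ`-nearby to `𝕍`* if `V ⊗_F 𝔸_F^τ ≃ 𝕍 ⊗_{𝔸_F} 𝔸_F^τ`, and `V ⊗_{F,τ} ℝ` has signature `(n−1, 1)`.»  **l. 4624**:
«It is clear that for every `τ ∈ Φ_F`, there exists a hermitian space that is `τ`-nearby to `𝕍`, unique up to
isomorphism. We fix such a space `V(τ)`. Put `G(τ) := Res_{F/ℚ} U(V(τ))`. We fix an isomorphism
`𝕍 ⊗_{𝔸_F} 𝔸_F^∞ ≃ V(τ) ⊗_F 𝔸_F^∞`, hence an isomorphism `𝔾(𝔸_F^∞) ≃ G(τ)(𝔸^∞)`.»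

**PROPOSITION C.5** (TeX label `pr:incoherent_shimura`, l. 4627–4633), VERBATIM:
«There is a projective system of schemes `{Sh(𝕍)_K}_K` over `E` indexed by sufficiently small open compact subgroups
`K` of `𝔾(𝔸_F^∞)`, such that for every `τ ∈ Φ_F` and every `τ' ∈ Φ_E` above it, we have an isomorphism
    `{Sh(𝕍)_K ⊗_{E,τ'} τ'(E)}_K ≃ {Sh(G(τ), h_{V(τ),τ'})_K}_K`
of projective systems of schemes over `τ'(E)`. Here, we use the fixed isomorphism `𝔾(𝔸_F^∞) ≃ G(τ)(𝔸^∞)` to regard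
`K` as a subgroup of `G(τ)(𝔸^∞)`.»  Proof (l. 4635–4637): «See [Gro, Section 10].» (`[Gro]` = B. Gross, *Incoherent
definite spaces and Shimura varieties*.)  **Def. C.6** (l. 4640–4642): «We call the projective system of schemes
`{Sh(𝕍)_K}_K` over `E` in Proposition C.5 the *Shimura varieties associated to `𝕍`*.»  **Rem. C.7** (l. 4644–4654):
«One can also interpret Proposition C.5 in the following way: The scheme `∏_{τ ∈ Φ_F} ∏_{τ' ∈ π^{−1}τ} Sh(G(τ),
h_{V(τ),τ'})_K` over `∏_{τ ∈ Φ_F} ∏_{τ' ∈ π^{−1}τ} Spec τ'(E) = ∏_{τ' ∈ Φ_E} Spec τ'(E)` descends to a scheme `Sh(𝕍)_K`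
over `Spec E`, where the above fiber products are taken over `Spec ℚ`.»

NOT printed in the statement (and therefore NOT binders here): `n ≥ 2` (App. C has `n ≥ 1`, l. 4618; §4.2's `n ≥ 2`,
l. 2053, is a hypothesis of Thm. 4.18, not of Prop. C.5); any condition on the degree `d = [F:ℚ]` beyond `d ≥ 1`; any
Galois / normal-closure condition on `E` or `F`; the Noncompact/Compact Case distinction (l. 2053–2058, l. 4656); any
level condition beyond «sufficiently small open compact» (neatness is how §C.1 indexes the right-hand side, l. 4599 —
see READING R2); any equivariance for the Hecke translations `Sh_K → Sh_{g^{-1}Kg}` (the printed sentence speaks of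
the «projective system … indexed by … subgroups `K`», i.e. of the transition morphisms `Sh_{K'} → Sh_K`, `K' ⊆ K`, only).

## The typing (paper order; `⟨CARRIER⟩` = posited datum, see above)

* `F`, `E`: `[NumberField F] [IsTotallyReal F] [NumberField E] [Algebra F E] [IsTotallyComplex E]
  [Algebra.IsQuadraticExtension F E]` — l. 4550, Mathlib's CM-extension vocabulary (as in `Thm418AsPrinted`, READING R1
  there; «degree `d ≥ 1`» is automatic).  `Φ_F := (F →+* ℝ)`, `Φ_E := (E →+* ℂ)`; «`τ' ∈ Φ_E` above `τ`» (i.e.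
  `π(τ') = τ`, `π` = restriction, l. 4550) is `C5.IsAbove τ τ' : τ' ∘ (F → E) = (ℝ → ℂ) ∘ τ`.  `τ'(E)` is the subfield
  `τ'.fieldRange ⊆ ℂ`, an `E`-algebra through `τ'.rangeRestrictField : E →+* τ'(E)`.
* `n`, `1 ≤ n` — l. 4618 («of rank `n ≥ 1`»).
* ⟨CARRIER⟩ `𝕍` (a bare token type) = the totally positive definite incoherent hermitian space over `𝔸_E` of rank `n` of
  l. 4618 (Def. C.3 quoted on the field); ⟨CARRIER⟩ `G` (a topological group) = `𝔾(𝔸_F^∞)`, `𝔾 := U(𝕍)` (l. 4618, 4627).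
  As in `Thm418AsPrinted`, `𝕍`'s printed attributes (rank `n`, incoherent, totally positive definite) are part of the
  MEANING of these two carriers; the sentence sees `𝕍` only through `𝔾(𝔸_F^∞)` and through the `V(τ)`.
* ⟨CARRIER⟩ `V τ` (token) = the FIXED hermitian space `V(τ)` over `E`, `τ`-nearby to `𝕍` (Def. C.4; l. 4624), for each
  `τ ∈ Φ_F`; ⟨CARRIER⟩ `Gτ τ` (a topological group) = `G(τ)(𝔸^∞) = U(V(τ))(𝔸_F^∞)`, `G(τ) := Res_{F/ℚ} U(V(τ))` (l. 4624,
  4599); `fix τ : G ≃ₜ* Gτ τ` — the FIXED isomorphism `𝔾(𝔸_F^∞) ≃ G(τ)(𝔸^∞)` of l. 4624 (induced by the fixed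
  `𝕍 ⊗_{𝔸_F} 𝔸_F^∞ ≃ V(τ) ⊗_F 𝔸_F^∞`), a genuine isomorphism of topological groups between the two carriers; it is how
  «we … regard `K` as a subgroup of `G(τ)(𝔸^∞)`» (l. 4632): `K ↦ fix τ (K)` is `C5.SmallLevel.transport (fix τ)`.
* ⟨CARRIER⟩ `Sh τ τ'` = the projective system `{Sh(G(τ), h_{V(τ),τ'})_K}_K` of §C.1 (l. 4579–4599 with Rem. C.2,
  l. 4602–4603: `V(τ)` has signature `(n−1,1)` at `τ` and — being `τ`-nearby to the totally positive definite `𝕍` —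
  `(n,0)` at the other places, so `h_{V(τ),τ'}` is defined for `τ'` above `τ` and its reflex field is `τ'(E)`): a functor
  from the poset of open compact subgroups of `G(τ)(𝔸^∞)` (inclusion) to schemes over `τ'(E)`, `K ↦ Sh(G(τ), h_{V(τ),τ'})_K`,
  `(K' ⊆ K) ↦` the transition morphism.  The text indexes this system by NEAT open compact `K` (l. 4599) and defines it for
  `τ'` ABOVE `τ`; the carrier is total (values at other `(τ, τ', K)` are never used: `PropC5AsPrinted` quantifies over
  `τ'` above `τ` only, and only over `K` below an existentially quantified threshold — READING R2).
* «projective system of schemes `{Sh(𝕍)_K}_K` over `E` indexed by sufficiently small open compact subgroups `K` of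
  `𝔾(𝔸_F^∞)`» = `∃ K₀` open compact and a functor `Sh𝕍 : C5.SmallLevel K₀ ⥤ SchemeOver E` from the poset of open compact
  `K ⊆ K₀` (READING R2: «sufficiently small» = below some open compact `K₀`, the standard meaning of the phrase and the
  reading R2 of `Thm418AsPrinted`; it is implied by, and for the sentence equivalent to, any reading in which the
  admissible levels form a downward-closed family containing a neighbourhood basis of `1`, e.g. «neat»).
* «`Sh(𝕍)_K ⊗_{E,τ'} τ'(E)`» = base change along `Spec τ'(E) → Spec E` induced by `τ' : E → τ'(E)`:
  `C5.baseChangeAlong τ'.rangeRestrictField : SchemeOver E ⥤ SchemeOver τ'(E)` (Mathlib `Over.pullback`; READING R3: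
  `⊗_{E,τ'}` = fibre product with `Spec τ'(E)` over `Spec E` via `τ'`, the meaning of the notation).
* «an isomorphism … of projective systems of schemes over `τ'(E)`» = a natural isomorphism, in the functor category
  `C5.SmallLevel K₀ ⥤ SchemeOver τ'(E)`, between `K ↦ Sh(𝕍)_K ⊗_{E,τ'} τ'(E)` and `K ↦ Sh(G(τ), h_{V(τ),τ'})_{fix τ (K)}`
  (READING R4: isomorphism of projective systems = levelwise isomorphisms commuting with the transition morphisms).

READINGS R1–R4 are the only interpretive choices; each is the standard meaning of the printed words and none adds or
removes a hypothesis.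

## Which hypotheses of Theorem 4.18 this feeds (for `Glue.lean` and the pin builders)

§4.2 (l. 2053–2074) builds the objects of Thm. 4.18 on top of Prop. C.5: «Let `𝕍` be a totally definite incoherent
hermitian space over `𝔸_E` of rank `n` (Definition C.3)» (l. 2053) and «`𝔾 := U(𝕍)`» (l. 2060) are the carriers
`Thm418Data.𝕍` and `Thm418Data.G` of `Thm418AsPrinted` = this file's `PropC5Data.𝕍`, `PropC5Data.G` (same objects, with
`2 ≤ n` there); «Let `{Sh(𝕍)_K}_K` be the projective system of Shimura varieties for `𝕍` indexed by sufficiently small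
open compact subgroups `K` of `𝔾(𝔸_F^∞)` (Definition C.6)» (l. 2060) IS the system `Sh𝕍` whose existence
`PropC5AsPrinted` asserts (Def. C.6 names it); from it §4.2 forms `X_K := \tilde Sh(𝕍)_K` (Def. C.8), `A_K := Alb(X_K)`,
`A_∞ := lim_K A_K` with its Hecke action (l. 2064–2074), hence the carriers `Thm418Data.HomK K D_μ = Hom_E(A_K, A_μ)_ℚ`,
`Thm418Data.res`, `Thm418Data.Ω = Ω(μ)` and `Thm418Data.rhoΩ` (Def. 4.16).  So Prop. C.5 feeds the MEANING of the
carriers `𝕍`, `G`, `HomK`, `res`, `Ω`, `rhoΩ` of `Thm418Data` (it is the existence-over-`E` statement behind them), and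
its isomorphisms `Sh(𝕍)_K ⊗_{E,τ'} τ'(E) ≃ Sh(G(τ), h_{V(τ),τ'})_K` are what identifies those `E`-schemes with Shimura
varieties of the nearby unitary groups `U(V(τ))` — the comparison the pinning record (`hReach`) needs.  No hypothesis of
Thm. 4.18 printed as a CONDITION (`n ≥ 2`, `μ` conjugate symplectic of weight one) comes from Prop. C.5.

T5: n/a (no multi-binder theorem: one hypothesis structure, one `Prop`-valued definition, bookkeeping lemmas).

## References

* [Liu2021] Y. Liu, *Fourier–Jacobi cycles and arithmetic relative trace formula*, Camb. J. Math. 9 (2021) 1–147,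
  arXiv:2102.11518 — App. C l. 4550; §C.1 l. 4558–4599, Rem. C.2 (l. 4602–4609), Def. C.3 (l. 4614–4616), l. 4618,
  Def. C.4 (l. 4620–4622), l. 4624, Prop. C.5 (l. 4627–4637), Def. C.6 (l. 4640–4642), Rem. C.7 (l. 4644–4654).
* [Gro] B. H. Gross, *Incoherent definite spaces and Shimura varieties*, §10 — the proof Liu cites (not used here).
-/

noncomputable section

open CategoryTheory AlgebraicGeometry NumberField
open Literature.AlgebraicGeometry.Motives (SchemeOver)

namespace Literature.NumberTheory.Automorphic.Liu2021.AppendixC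

/-! ## Auxiliary vocabulary for Proposition C.5 (namespace `C5`) -/

namespace C5

/-- «every `τ' ∈ Φ_E` above `τ ∈ Φ_F`» (l. 4628), for the restriction map `π : Φ_E → Φ_F` of l. 4550 («We have the
projection map `π : Φ_E → Φ_F` given by restriction»): the complex embedding `τ'` of `E` restricts on `F` to the real
embedding `τ`. [cite: Liu2021, App. C l. 4550 and Prop. C.5 l. 4628] -/
def IsAbove {F E : Type} [Field F] [Field E] [Algebra F E] (τ : F →+* ℝ) (τ' : E →+* ℂ) : Prop :=
  τ'.comp (algebraMap F E) = Complex.ofRealHom.comp τ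

/-- The open compact subgroups of a topological group, ordered by inclusion (the index set of the projective systems of
l. 4599 «open compact subgroups `K` of `G(𝔸^∞)`» and l. 4627–4628 «open compact subgroups `K` of `𝔾(𝔸_F^∞)`»).
[cite: Liu2021, App. C l. 4599 and Prop. C.5 l. 4627–4628] -/
abbrev OpenCompactSubgroup (H : Type) [Group H] [TopologicalSpace H] : Type :=
  {K : Subgroup H // IsOpen (K : Set H) ∧ IsCompact (K : Set H)}

/-- «sufficiently small open compact subgroups `K`» (l. 4627–4628), READING R2: the open compact subgroups contained
in a threshold `K₀`, ordered by inclusion (a poset, hence a category; a functor out of it is a projective system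
`K' ⊆ K ↦ (X_{K'} → X_K)`). [cite: Liu2021, Prop. C.5 l. 4627–4628] -/
abbrev SmallLevel {H : Type} [Group H] [TopologicalSpace H] (K₀ : OpenCompactSubgroup H) : Type :=
  {K : OpenCompactSubgroup H // K ≤ K₀}

section Transport

variable {H H' : Type} [Group H] [TopologicalSpace H] [Group H'] [TopologicalSpace H']

/-- «we use the fixed isomorphism `𝔾(𝔸_F^∞) ≃ G(τ)(𝔸^∞)` to regard `K` as a subgroup of `G(τ)(𝔸^∞)`» (l. 4632): the
image of an open compact subgroup under an isomorphism of topological groups is an open compact subgroup.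
[cite: Liu2021, Prop. C.5 l. 4632] -/
def OpenCompactSubgroup.transport (e : H ≃ₜ* H') (K : OpenCompactSubgroup H) : OpenCompactSubgroup H' :=
  ⟨K.1.map e.toMulEquiv.toMonoidHom, by
    have hcoe : ((K.1.map e.toMulEquiv.toMonoidHom : Subgroup H') : Set H') = e.toHomeomorph '' (K.1 : Set H) :=
      Subgroup.coe_map _ _
    refine ⟨?_, ?_⟩
    · rw [hcoe]
      exact e.toHomeomorph.isOpen_image.2 K.2.1
    · rw [hcoe]
      exact e.toHomeomorph.isCompact_image.2 K.2.2⟩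

/-- Transport of levels is monotone (`K' ⊆ K ⇒ e(K') ⊆ e(K)`): «regard `K` as a subgroup of `G(τ)(𝔸^∞)`» respects the
projective systems' index order. [cite: Liu2021, Prop. C.5 l. 4632] -/
theorem OpenCompactSubgroup.transport_mono (e : H ≃ₜ* H') : Monotone (OpenCompactSubgroup.transport e) :=
  fun _ _ h => Subgroup.map_mono h

/-- The underlying subgroup of the transported level is the image `e(K)` («regard `K` as a subgroup of `G(τ)(𝔸^∞)`»,
unfolded). [cite: Liu2021, Prop. C.5 l. 4632] -/
@[simp] theorem OpenCompactSubgroup.coe_transport (e : H ≃ₜ* H') (K : OpenCompactSubgroup H) :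
    ((OpenCompactSubgroup.transport e K).1 : Set H') = e '' (K.1 : Set H) :=
  Subgroup.coe_map _ _

/-- «regard `K` as a subgroup of `G(τ)(𝔸^∞)`» (l. 4632) as a functor on the sufficiently small levels: the
re-indexing `K ↦ e(K)` from the open compact `K ⊆ K₀` of `H` to the open compact subgroups of `H'`.
[cite: Liu2021, Prop. C.5 l. 4632] -/
def SmallLevel.transport (e : H ≃ₜ* H') (K₀ : OpenCompactSubgroup H) : SmallLevel K₀ ⥤ OpenCompactSubgroup H' :=
  Monotone.functor (f := fun K : SmallLevel K₀ => OpenCompactSubgroup.transport e K.1)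
    fun _ _ h => OpenCompactSubgroup.transport_mono e h

/-- On objects the re-indexing functor is `K ↦ e(K)` (l. 4632, unfolded). [cite: Liu2021, Prop. C.5 l. 4632] -/
@[simp] theorem SmallLevel.transport_obj (e : H ≃ₜ* H') (K₀ : OpenCompactSubgroup H) (K : SmallLevel K₀) :
    (SmallLevel.transport e K₀).obj K = OpenCompactSubgroup.transport e K.1 :=
  rfl

end Transport

/-- «`Sh(𝕍)_K ⊗_{E,τ'} τ'(E)`» (l. 4630), READING R3: base change of schemes over a field `K` along a ring homomorphism
`f : K → L` — the fibre product with `Spec L` over `Spec K`, i.e. Mathlib's pullback functor `Over (Spec K) ⥤ Over (Spec L)`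
along `Spec f` (the tree's `Motives.baseChange` for the algebra structure given by `f`). Used with `f = τ' : E → τ'(E)`.
[cite: Liu2021, Prop. C.5 l. 4630] -/
def baseChangeAlong {K L : Type} [CommRing K] [CommRing L] (f : K →+* L) : SchemeOver K ⥤ SchemeOver L :=
  Over.pullback (Spec.map (CommRingCat.ofHom f))

end C5

/-! ## The data of Proposition C.5, in the order the appendix introduces them -/

/-- **The data and standing hypotheses of [Liu2021, Prop. C.5]**, in paper order, over the number fields `F ⊆ E` of
l. 4550 (parameters, with their printed hypotheses as instance arguments: `F` totally real, `E/F` totally imaginary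
quadratic).  Fields marked ⟨CARRIER⟩ are posited data standing for printed objects Lean cannot construct (module
docstring, «What a CARRIER is»); the other fields are genuine objects / genuine printed hypotheses.  Nothing is asserted
by this structure. [cite: Liu2021, App. C l. 4550, §C.1 l. 4558–4599, Rem. C.2, Def. C.3, l. 4618, Def. C.4, l. 4624] -/
structure PropC5Data (F E : Type) [Field F] [NumberField F] [IsTotallyReal F] [Field E] [NumberField E]
    [Algebra F E] [IsTotallyComplex E] [Algebra.IsQuadraticExtension F E] : Type 1 where
  /-- «of some rank `n ≥ 1`» (Def. C.3, l. 4614) / «of rank `n ≥ 1`» (l. 4618): the rank of `𝕍`. -/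
  n : ℕ
  /-- «`n ≥ 1`» (l. 4614, 4618). -/
  one_le_n : 1 ≤ n
  /-- ⟨CARRIER⟩ (token) `𝕍`: «Let `𝕍` be a totally positive definite incoherent hermitian space over `𝔸_E` of rank `n ≥ 1`»
  (l. 4618) — Def. C.3 (l. 4614–4616): «An *incoherent hermitian space* over `𝔸_E` is a free `𝔸_E`-module `𝕍` of some
  rank `n ≥ 1`, equipped with a non-degenerate hermitian form `( , )_𝕍 : 𝕍 × 𝕍 → 𝔸_E` with respect to the (induced)
  involution `c` on `𝔸_E` such that its determinant belongs to `𝔸_F^× ∖ F^× Nm_{𝔸_E/𝔸_F} 𝔸_E^×`. We say that `𝕍` is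
  totally positive definite if for every `τ ∈ Φ_F`, `𝕍 ⊗_{𝔸_F,τ} ℝ` is positive definite.»  A bare type standing for the
  space (no adèlic hermitian spaces in Mathlib / the tree; the sibling file `AppendixC/DefC1toC3.lean` types Def. C.3 and
  `Glue.lean` instantiates this token on it); its printed attributes — rank `n`, incoherent, totally positive definite —
  are part of the MEANING of this token, of `G` and of the `V τ` below. -/
  𝕍 : Type
  /-- ⟨CARRIER⟩ `G = 𝔾(𝔸_F^∞)`, the group of finite-adèlic points of «`𝔾 := U(𝕍)` … its group of isometry, which is a
  reductive group over `𝔸_F`» (l. 4618), for the `𝕍` above; a topological group (locally compact, totally disconnected).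
  Its open compact subgroups index the left-hand side of Prop. C.5 (l. 4627–4628). -/
  G : Type
  [instGroup : Group G]
  [instTopologicalSpace : TopologicalSpace G]
  [instIsTopologicalGroup : IsTopologicalGroup G]
  /-- ⟨CARRIER⟩ (token) `V τ = V(τ)`, for each `τ ∈ Φ_F` the FIXED hermitian space over `E` that is `τ`-nearby to `𝕍`
  (l. 4624: «It is clear that for every `τ ∈ Φ_F`, there exists a hermitian space that is `τ`-nearby to `𝕍`, unique up to
  isomorphism. We fix such a space `V(τ)`.»; Def. C.4, l. 4620–4622: «For `τ ∈ Φ_F`, we say that a hermitian space `V`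
  over `E` is *`τ`-nearby to `𝕍`* if `V ⊗_F 𝔸_F^τ ≃ 𝕍 ⊗_{𝔸_F} 𝔸_F^τ`, and `V ⊗_{F,τ} ℝ` has signature `(n−1, 1)`.»; a
  hermitian space over `E`: l. 4558).  A bare type (the sibling file `AppendixC/DefC4.lean` types Def. C.4; `Glue.lean`
  instantiates); being `τ`-nearby to the totally positive definite `𝕍`, `V(τ)` has signature `(n−1,1)` at `τ` and `(n,0)`
  at every other `τ₀ ∈ Φ_F`, the situation of Rem. C.2. -/
  V : (F →+* ℝ) → Type
  /-- ⟨CARRIER⟩ `Gτ τ = G(τ)(𝔸^∞) = U(V(τ))(𝔸_F^∞)`, the group of finite-adèlic points of «`G(τ) := Res_{F/ℚ} U(V(τ))`»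
  (l. 4624; `U(V)` = the unitary group of isometries of `V`, l. 4569–4571; `G(𝔸^∞) = U(V)(𝔸_F^∞)`, l. 4599), a
  topological group, for each `τ ∈ Φ_F`.  Its (neat) open compact subgroups index the Shimura varieties `Sh τ τ'` below. -/
  Gτ : (F →+* ℝ) → Type
  [instGroupτ : ∀ τ, Group (Gτ τ)]
  [instTopologicalSpaceτ : ∀ τ, TopologicalSpace (Gτ τ)]
  [instIsTopologicalGroupτ : ∀ τ, IsTopologicalGroup (Gτ τ)]
  /-- The FIXED isomorphism of topological groups `𝔾(𝔸_F^∞) ≃ G(τ)(𝔸^∞)` of l. 4624 («We fix an isomorphism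
  `𝕍 ⊗_{𝔸_F} 𝔸_F^∞ ≃ V(τ) ⊗_F 𝔸_F^∞`, hence an isomorphism `𝔾(𝔸_F^∞) ≃ G(τ)(𝔸^∞)`»), for each `τ ∈ Φ_F`; it is the
  isomorphism through which Prop. C.5 «regard[s] `K` as a subgroup of `G(τ)(𝔸^∞)`» (l. 4632).  A genuine isomorphism
  between the two carriers (that it is INDUCED by an isometry of hermitian spaces over `𝔸_E^∞` is part of its meaning). -/
  fix : ∀ τ : F →+* ℝ, G ≃ₜ* Gτ τ
  /-- ⟨CARRIER⟩ `Sh τ τ'` = the projective system of Shimura varieties `{Sh(G(τ), h_{V(τ),τ'})_K}_K` over `τ'(E)`, for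
  `τ ∈ Φ_F` and `τ' ∈ Φ_E` above `τ` (§C.1, l. 4579–4599: «Put `G := Res_{F/ℚ} U(V)`. We define the Hodge map
  `h^♭_{V,Φ} : Res_{ℂ/ℝ} 𝔾_m → G_ℝ` … Then we obtain a Shimura data `(G, h^♭_{V,Φ})`. It is of abelian type but not Hodge
  type; and its reflex field coincides with `E^♭_{V,Φ}`. The theory of Shimura varieties provides us with a projective
  system of schemes `{Sh(G, h^♭_{V,Φ})_K}_K`, quasi-projective and smooth over `E^♭_{V,Φ}` of dimension `Σ_{τ ∈ Φ_F} p_τ q_τ`,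
  indexed by neat open compact subgroups `K` of `G(𝔸^∞) = U(V)(𝔸_F^∞)`.»; Rem. C.2, l. 4602–4603: «Suppose that there is
  an element `τ ∈ Φ_F` such that `V` has signature `(n−1,1)` at `τ` and `(n,0)` at other places. Then the Hodge map
  `h^♭_{V,Φ}` hence the Shimura variety `Sh(G, h^♭_{V,Φ})_K` depend only on `Φ ∩ π^{−1}τ` … Thus, for an element `τ' ∈ Φ_E`
  above `τ`, we may write `h_{V,τ'}` and `Sh(G, h_{V,τ'})_K` for those `Φ` containing `τ'`. In particular, the reflex
  field of `h_{V,τ'}` is `τ'(E)`.»), applied to `V = V(τ)`, `G = G(τ)`: a functor from the open compact subgroups of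
  `G(τ)(𝔸^∞)` (inclusion order) to schemes over the subfield `τ'(E) = τ'.fieldRange ⊆ ℂ`, `K ↦ Sh(G(τ), h_{V(τ),τ'})_K`,
  `(K' ⊆ K) ↦` the transition morphism `Sh_{K'} → Sh_K`.  The canonical models of Shimura varieties do not exist in
  Mathlib / the tree.  The text defines this system for `τ'` ABOVE `τ` and indexes it by NEAT `K`; the carrier is
  total, and its values at other `(τ, τ')` or at non-neat `K` are never used by `PropC5AsPrinted` (READING R2). -/
  Sh : ∀ (τ : F →+* ℝ) (τ' : E →+* ℂ), C5.OpenCompactSubgroup (Gτ τ) ⥤ SchemeOver τ'.fieldRange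

attribute [instance] PropC5Data.instGroup PropC5Data.instTopologicalSpace PropC5Data.instIsTopologicalGroup
  PropC5Data.instGroupτ PropC5Data.instTopologicalSpaceτ PropC5Data.instIsTopologicalGroupτ

/-! ## Proposition C.5 as printed -/

/-- **[Liu2021, Proposition C.5] EXACTLY AS PRINTED** (`FJcycle.tex` l. 4627–4633, TeX label `pr:incoherent_shimura`),
for the datum `D` (standing hypotheses l. 4550: `F` totally real, `E/F` totally imaginary quadratic — the instance
arguments; l. 4618: `𝕍` totally positive definite incoherent of rank `n ≥ 1`, `𝔾 = U(𝕍)`; l. 4624: the fixed `V(τ)`,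
`G(τ)`, and the fixed isomorphisms `𝔾(𝔸_F^∞) ≃ G(τ)(𝔸^∞)`; §C.1 + Rem. C.2: the Shimura varieties
`Sh(G(τ), h_{V(τ),τ'})_K` over `τ'(E)` — the carriers of `PropC5Data`):

«There is a projective system of schemes `{Sh(𝕍)_K}_K` over `E` indexed by sufficiently small open compact subgroups `K`
of `𝔾(𝔸_F^∞)`, such that for every `τ ∈ Φ_F` and every `τ' ∈ Φ_E` above it, we have an isomorphism
`{Sh(𝕍)_K ⊗_{E,τ'} τ'(E)}_K ≃ {Sh(G(τ), h_{V(τ),τ'})_K}_K` of projective systems of schemes over `τ'(E)`. Here, we use the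
fixed isomorphism `𝔾(𝔸_F^∞) ≃ G(τ)(𝔸^∞)` to regard `K` as a subgroup of `G(τ)(𝔸^∞)`.»

TYPED as: `∃ K₀` open compact in `𝔾(𝔸_F^∞)` and `∃ Sh𝕍 : C5.SmallLevel K₀ ⥤ SchemeOver E` (a projective system of
`E`-schemes indexed by the open compact `K ⊆ K₀`, READING R2) such that `∀ τ : F →+* ℝ`, `∀ τ' : E →+* ℂ` above `τ`
(`C5.IsAbove`), there is (`Nonempty`) a natural isomorphism, in `C5.SmallLevel K₀ ⥤ SchemeOver τ'(E)`, between
`K ↦ Sh(𝕍)_K ⊗_{E,τ'} τ'(E)` (`Sh𝕍 ⋙ C5.baseChangeAlong τ'.rangeRestrictField`, READING R3) and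
`K ↦ Sh(G(τ), h_{V(τ),τ'})_{fix τ (K)}` (`C5.SmallLevel.transport (D.fix τ) K₀ ⋙ D.Sh τ τ'`) (READING R4).  READINGS
R1–R4 of the module docstring; no hypothesis added, none dropped (in particular no `n ≥ 2`, no condition on `[F:ℚ]`, no
Galois / compactness / level condition, no Hecke equivariance — none is printed).  A consumer takes
`(h : PropC5AsPrinted D)` for ITS OWN `D`; `∀ D, PropC5AsPrinted D` is not the proposition and is not claimed.  NO PROOF
(Track 2; Liu: «See [Gro, Section 10]»). [cite: Liu2021, Prop. C.5] -/
def PropC5AsPrinted {F E : Type} [Field F] [NumberField F] [IsTotallyReal F] [Field E] [NumberField E] [Algebra F E]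
    [IsTotallyComplex E] [Algebra.IsQuadraticExtension F E] (D : PropC5Data F E) : Prop :=
  ∃ (K₀ : C5.OpenCompactSubgroup D.G) (Sh𝕍 : C5.SmallLevel K₀ ⥤ SchemeOver E),
    -- «such that for every τ ∈ Φ_F and every τ' ∈ Φ_E above it, we have an isomorphism … of projective systems of
    -- schemes over τ'(E)» (l. 4628–4632)
    ∀ (τ : F →+* ℝ) (τ' : E →+* ℂ), C5.IsAbove τ τ' →
      Nonempty ((Sh𝕍 ⋙ C5.baseChangeAlong τ'.rangeRestrictField) ≅
        (C5.SmallLevel.transport (D.fix τ) K₀ ⋙ D.Sh τ τ'))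

namespace PropC5Data

variable {F E : Type} [Field F] [NumberField F] [IsTotallyReal F] [Field E] [NumberField E] [Algebra F E]
  [IsTotallyComplex E] [Algebra.IsQuadraticExtension F E] {D : PropC5Data F E}

/-- Dot-notation alias: `D.PropC5AsPrinted`. [cite: Liu2021, Prop. C.5] -/
protected abbrev PropC5AsPrinted (D : PropC5Data F E) : Prop := AppendixC.PropC5AsPrinted D

/-- Levelwise form of Prop. C.5 (READING R4 unfolded): from the printed isomorphism of projective systems, for every
sufficiently small `K` and every `τ'` above `τ` an isomorphism of `τ'(E)`-schemes
`Sh(𝕍)_K ⊗_{E,τ'} τ'(E) ≅ Sh(G(τ), h_{V(τ),τ'})_{fix τ (K)}` (the component of the natural isomorphism at `K`).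
Bookkeeping consequence, ours. [cite: Liu2021, Prop. C.5] -/
theorem exists_levelwise_iso (h : AppendixC.PropC5AsPrinted D) :
    ∃ (K₀ : C5.OpenCompactSubgroup D.G) (Sh𝕍 : C5.SmallLevel K₀ ⥤ SchemeOver E),
      ∀ (τ : F →+* ℝ) (τ' : E →+* ℂ), C5.IsAbove τ τ' → ∀ K : C5.SmallLevel K₀,
        Nonempty ((C5.baseChangeAlong τ'.rangeRestrictField).obj (Sh𝕍.obj K) ≅
          (D.Sh τ τ').obj (C5.OpenCompactSubgroup.transport (D.fix τ) K.1)) := by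
  obtain ⟨K₀, Sh𝕍, hiso⟩ := h
  refine ⟨K₀, Sh𝕍, fun τ τ' hτ K => ?_⟩
  obtain ⟨i⟩ := hiso τ τ' hτ
  exact ⟨i.app K⟩

/-- **The binder list is inhabited** (hypothesis non-vacuity, not a statement about Liu's objects): over every CM
extension `E/F` as in l. 4550 the carriers can be instantiated (trivially: `n := 1`, one-point token types, the trivial
topological group, identity isomorphisms, constant systems `K ↦ Spec τ'(E)`).  Our bookkeeping.
[cite: Liu2021, App. C l. 4550, l. 4618, l. 4624] -/
theorem nonempty (F E : Type) [Field F] [NumberField F] [IsTotallyReal F] [Field E] [NumberField E] [Algebra F E]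
    [IsTotallyComplex E] [Algebra.IsQuadraticExtension F E] : Nonempty (PropC5Data F E) :=
  ⟨{ n := 1, one_le_n := le_rfl, 𝕍 := PUnit, G := PUnit, V := fun _ => PUnit, Gτ := fun _ => PUnit,
     fix := fun _ => ContinuousMulEquiv.refl PUnit,
     Sh := fun _ τ' => (Functor.const _).obj (Over.mk (𝟙 (Spec (CommRingCat.of τ'.fieldRange)))) }⟩

end PropC5Data

end Literature.NumberTheory.Automorphic.Liu2021.AppendixC
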